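import Literature.NumberTheory.GaloisRepresentations.RayClassGroupFinite
import Literature.NumberTheory.LFunctions.RayClassFamily
import HarnessLib

/-!
# The order of the narrow ray class group: `|Cl_K^𝔪| ≤ h_K · N𝔪² · 2^{n_K} ≤ Q_𝔪⁴`

Topic `Summits/QuantumAdvantage/QuantumAdvantage/Theorems`, cell B2b-1 (linnik-cubic), PART A (gen 22); helper toward the
crux `DegreeOnePrimesEscape` (stmt-QuantumAdvantage-11543) of route `LinnikCubicClassGroups`.  HONEST FRAMING: the value of
this file is a THEOREM (kernel-checked lemma) — NOT summit progress.

The size hypothesis `|G| ≤ Q_𝔪⁴` of the ray-class Linnik chain (`…RayClassDHSmoothed`, `…RayClassLinnik`), discharged for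
the canonical datum `G = Cl_K^𝔪`:
* `natCard_rayClassGroup_le` — `|Cl_K^𝔪| ≤ h_K · N𝔪² · 2^{n_K}`: the narrow ray classes of the nonzero integral ideals prime
  to `𝔪` exhaust `Cl_K^𝔪` (`integralRayClass_surjective`) and the class of `𝔞` is determined by its TYPE
  `(cl 𝔞, x mod 𝔪, y mod 𝔪, signs of τ(xy))` (`CoprimeIdeal.rayClassRel_of_type_eq`, the proof of Neukirch VI (1.8)/(1.9)
  already in the tree), which ranges over `Cl_K × (𝓞/𝔪)² × {±}^{Hom(K,ℝ)}`; a crude form of the exact sequence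
  `(𝓞/𝔪)ˣ × ∏_{real} ℝˣ/ℝˣ₊ → Cl_K^𝔪 → Cl_K → 1` (Neukirch VI (1.11));
* `natCard_rayClassGroup_le_rayCondQ_pow` — hence `|Cl_K^𝔪| ≤ Q_𝔪⁴`, `Q_𝔪 = |d_K| n^n N𝔪`, for `n_K > 1`
  (`h_K ≤ (4e)^n |d_K|`, `(8e)^n ≤ |d_K|³ n^{4n}`).
References: J. Neukirch, *Algebraic Number Theory*, Ch. VI §1 (1.8), (1.9), (1.11) [NeukirchANT1999].
-/

noncomputable section

open NumberField IsDedekindDomain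
open scoped NumberField nonZeroDivisors

namespace Summit.QuantumAdvantage.QuantumAdvantage.Theorems.DegreeOnePrimesEscape

open Literature.NumberTheory.LFunctions Literature.NumberTheory.LFunctions.NumberField
  Literature.NumberTheory.LFunctions.AbelianDensity Literature.NumberTheory.GaloisRepresentations
open scoped Classical

variable {K : Type} [Field K] [NumberField K] {𝔪 : Ideal (𝓞 K)}

/-- The real embeddings of a number field are finitely many, at most `n_K` of them. -/
theorem natCard_ringHom_real_le : Nat.card (K →+* ℝ) ≤ Module.finrank ℚ K := by
  have hinj : Function.Injective (fun φ : K →+* ℝ ↦ (Complex.ofRealHom).comp φ) := by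
    intro φ ψ h
    ext x
    have := DFunLike.congr_fun h x
    simpa using this
  calc Nat.card (K →+* ℝ) ≤ Nat.card (K →+* ℂ) := Nat.card_le_card_of_injective _ hinj
    _ = Module.finrank ℚ K := by rw [Nat.card_eq_fintype_card, NumberField.Embeddings.card]

/-- The real embeddings form a finite type. -/
theorem finite_ringHom_real : Finite (K →+* ℝ) := by
  have hinj : Function.Injective (fun φ : K →+* ℝ ↦ (Complex.ofRealHom).comp φ) := by
    intro φ ψ h
    ext x
    have := DFunLike.congr_fun h x
    simpa using this
  exact Finite.of_injective _ hinj

/-- **`|Cl_K^𝔪| ≤ h_K · N𝔪² · 2^{n_K}`** for `𝔪 ≠ 0` (see the module docstring).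
[cite: NeukirchANT1999, Ch. VI §1 Prop. (1.8) and (1.9)] -/
theorem natCard_rayClassGroup_le (h𝔪 : 𝔪 ≠ ⊥) :
    Nat.card (RayClassGroup 𝔪) ≤
      Fintype.card (ClassGroup (𝓞 K)) * (Ideal.absNorm 𝔪 * Ideal.absNorm 𝔪) * 2 ^ Module.finrank ℚ K := by
  haveI : Finite (𝓞 K ⧸ 𝔪) := Ideal.finiteQuotientOfFreeOfNeBot 𝔪 h𝔪
  haveI := finite_rayClassQuotient (K := K) h𝔪
  haveI : Finite (K →+* ℝ) := finite_ringHom_real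
  -- (1) the integral classes exhaust `Cl_K^𝔪`
  have h1 : Nat.card (RayClassGroup 𝔪) ≤ Nat.card (Quotient (rayClassSetoid 𝔪)) := by
    set g : Quotient (rayClassSetoid 𝔪) → RayClassGroup 𝔪 :=
      Quotient.lift (integralRayClass 𝔪 h𝔪) fun 𝔞 𝔟 h ↦ ((integralRayClass_eq_iff h𝔪 𝔞 𝔟).mpr h).symm with hg
    refine Nat.card_le_card_of_surjective g fun x ↦ ?_
    obtain ⟨𝔞, rfl⟩ := integralRayClass_surjective h𝔪 x
    exact ⟨Quotient.mk _ 𝔞, rfl⟩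
  -- (2) the class of `𝔞` is determined by its type
  have h2 : Nat.card (Quotient (rayClassSetoid 𝔪)) ≤ Nat.card (Set.range (CoprimeIdeal.type (𝔪 := 𝔪))) := by
    set g : Set.range (CoprimeIdeal.type (𝔪 := 𝔪)) → Quotient (rayClassSetoid 𝔪) :=
      fun t ↦ Quotient.mk _ t.2.choose with hg
    refine Nat.card_le_card_of_surjective g fun q ↦ ?_
    induction q using Quotient.inductionOn with
    | h 𝔞 =>
      refine ⟨⟨𝔞.type, 𝔞, rfl⟩, ?_⟩
      refine Quotient.sound ?_
      have hmem : (𝔞.type) ∈ Set.range (CoprimeIdeal.type (𝔪 := 𝔪)) := ⟨𝔞, rfl⟩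
      change (rayClassSetoid 𝔪).r hmem.choose 𝔞
      rw [rayClassSetoid_r_iff]
      exact CoprimeIdeal.rayClassRel_of_type_eq hmem.choose_spec
  -- (3) the types range over `Cl_K × (𝓞/𝔪)² × (Hom(K,ℝ) → Prop)`
  have h3 : Nat.card (Set.range (CoprimeIdeal.type (𝔪 := 𝔪))) ≤
      Nat.card (ClassGroup (𝓞 K) × (𝓞 K ⧸ 𝔪) × (𝓞 K ⧸ 𝔪) × ((K →+* ℝ) → Prop)) :=
    Nat.card_le_card_of_injective (Subtype.val) Subtype.val_injective
  -- (4) count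
  have hquot : Nat.card (𝓞 K ⧸ 𝔪) = Ideal.absNorm 𝔪 := by
    rw [Ideal.absNorm_apply, Submodule.cardQuot_apply]
  have hprop : Nat.card ((K →+* ℝ) → Prop) ≤ 2 ^ Module.finrank ℚ K := by
    rw [Nat.card_fun, show Nat.card Prop = 2 by rw [Nat.card_eq_fintype_card, Fintype.card_prop]]
    exact Nat.pow_le_pow_right (by norm_num) natCard_ringHom_real_le
  have h4 : Nat.card (ClassGroup (𝓞 K) × (𝓞 K ⧸ 𝔪) × (𝓞 K ⧸ 𝔪) × ((K →+* ℝ) → Prop)) ≤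
      Fintype.card (ClassGroup (𝓞 K)) * (Ideal.absNorm 𝔪 * Ideal.absNorm 𝔪) * 2 ^ Module.finrank ℚ K := by
    rw [Nat.card_prod, Nat.card_prod, Nat.card_prod, hquot, Nat.card_eq_fintype_card]
    calc Fintype.card (ClassGroup (𝓞 K)) * (Ideal.absNorm 𝔪 * (Ideal.absNorm 𝔪 * Nat.card ((K →+* ℝ) → Prop)))
        = Fintype.card (ClassGroup (𝓞 K)) * (Ideal.absNorm 𝔪 * Ideal.absNorm 𝔪) * Nat.card ((K →+* ℝ) → Prop) := by
          ring
      _ ≤ _ := Nat.mul_le_mul_left _ hprop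
  exact h1.trans (h2.trans (h3.trans h4))

/-- **`|Cl_K^𝔪| ≤ Q_𝔪⁴`**, `Q_𝔪 = |d_K| n^n N𝔪` (`rayCondQ`), for every number field of degree `n > 1` and every `𝔪 ≠ 0`
(`h_K ≤ (4e)^n |d_K|`, `2^n (4e)^n = (8e)^n ≤ 22^n ≤ |d_K|³ n^{4n}`). [cite: NeukirchANT1999, Ch. VI §1 Prop. (1.8)] -/
theorem natCard_rayClassGroup_le_rayCondQ_pow (hK : 1 < Module.finrank ℚ K) (h𝔪 : 𝔪 ≠ ⊥) :
    (Nat.card (RayClassGroup 𝔪) : ℝ) ≤ rayCondQ K 𝔪 ^ (4 : ℕ) := by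
  set n : ℕ := Module.finrank ℚ K with hn
  set d : ℝ := |(discr K : ℝ)| with hd
  set N : ℝ := ((Ideal.absNorm 𝔪 : ℕ) : ℝ) with hN
  have hcard := natCard_rayClassGroup_le (K := K) h𝔪
  have hcardR : (Nat.card (RayClassGroup 𝔪) : ℝ) ≤
      (Fintype.card (ClassGroup (𝓞 K)) : ℝ) * (N * N) * (2 : ℝ) ^ n := by
    rw [hN, hn]; exact_mod_cast hcard
  have hh : (Fintype.card (ClassGroup (𝓞 K)) : ℝ) ≤ (4 * Real.exp 1) ^ n * d :=
    classNumber_le_exp_mul_absdiscr K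
  have hd3 : (3 : ℝ) ≤ d := by
    have h2 := NumberField.abs_discr_gt_two hK
    rw [hd]
    exact_mod_cast (show (3 : ℤ) ≤ |discr K| by omega)
  have hd1 : (1 : ℝ) ≤ d := by linarith
  have hN1 : (1 : ℝ) ≤ N := one_le_absNorm_cast h𝔪
  have hn2 : 2 ≤ n := hK
  have hn0 : (0 : ℝ) < n := by exact_mod_cast (by omega : 0 < n)
  have he : Real.exp 1 < 2.7182818286 := Real.exp_one_lt_d9
  have he0 : 0 < Real.exp 1 := Real.exp_pos 1
  -- `(4e)^n · 2^n = (8e)^n ≤ 22^n`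
  have h8e : (4 * Real.exp 1) ^ n * (2 : ℝ) ^ n ≤ (22 : ℝ) ^ n := by
    rw [← mul_pow]
    exact pow_le_pow_left₀ (by positivity) (by nlinarith) n
  -- `22^n ≤ d³ (nⁿ)⁴`
  have hnn4 : ((n : ℝ) ^ n) ^ 4 = ((n : ℝ) ^ 4) ^ n := by rw [← pow_mul, ← pow_mul, mul_comm]
  have h22 : (22 : ℝ) ^ n ≤ d ^ 3 * ((n : ℝ) ^ n) ^ 4 := by
    rw [hnn4]
    rcases Nat.lt_or_ge n 3 with hlt | hge
    · have hn2' : n = 2 := by omega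
      have hd27 : (27 : ℝ) ≤ d ^ 3 := by
        have := pow_le_pow_left₀ (by norm_num : (0 : ℝ) ≤ 3) hd3 3; norm_num at this; linarith
      rw [hn2']; norm_num; nlinarith
    · have hn3 : (3 : ℝ) ≤ n := by exact_mod_cast hge
      have hn4 : (22 : ℝ) ≤ (n : ℝ) ^ 4 := by
        have := pow_le_pow_left₀ (by norm_num : (0 : ℝ) ≤ 3) hn3 4; norm_num at this; linarith
      have h1 : (22 : ℝ) ^ n ≤ ((n : ℝ) ^ 4) ^ n := pow_le_pow_left₀ (by norm_num) hn4 n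
      have h3 : (1 : ℝ) ≤ d ^ 3 := one_le_pow₀ hd1
      have h0 : (0 : ℝ) ≤ ((n : ℝ) ^ 4) ^ n := by positivity
      nlinarith
  -- assemble: `h N² 2ⁿ ≤ (4e)ⁿ d N² 2ⁿ ≤ 22ⁿ d N² ≤ d⁴ n^{4n} N⁴ = Q_𝔪⁴`
  have hQ : rayCondQ K 𝔪 ^ (4 : ℕ) = d ^ 4 * ((n : ℝ) ^ n) ^ 4 * N ^ 4 := by
    unfold rayCondQ ThornerZaman.condQn; rw [← hd, ← hn, ← hN]; ring
  rw [hQ]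
  have hN2 : N * N ≤ N ^ 4 := by
    have hNN : 1 ≤ N * N := one_le_mul_of_one_le_of_one_le hN1 hN1
    have h0 : 0 ≤ N * N := by positivity
    nlinarith [mul_le_mul_of_nonneg_left hNN h0]
  calc (Nat.card (RayClassGroup 𝔪) : ℝ) ≤ (Fintype.card (ClassGroup (𝓞 K)) : ℝ) * (N * N) * (2 : ℝ) ^ n := hcardR
    _ ≤ ((4 * Real.exp 1) ^ n * d) * (N * N) * (2 : ℝ) ^ n := by gcongr
    _ = ((4 * Real.exp 1) ^ n * (2 : ℝ) ^ n) * d * (N * N) := by ring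
    _ ≤ (22 : ℝ) ^ n * d * (N * N) := by gcongr
    _ ≤ (d ^ 3 * ((n : ℝ) ^ n) ^ 4) * d * N ^ 4 := by
        have h0 : 0 ≤ (22 : ℝ) ^ n * d := by positivity
        have h0' : 0 ≤ d ^ 3 * ((n : ℝ) ^ n) ^ 4 * d := by positivity
        nlinarith [mul_le_mul_of_nonneg_right h22 (by positivity : (0 : ℝ) ≤ d)]
    _ = d ^ 4 * ((n : ℝ) ^ n) ^ 4 * N ^ 4 := by ring

end Summit.QuantumAdvantage.QuantumAdvantage.Theorems.DegreeOnePrimesEscape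

end
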